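import Summits.BirchSwinnertonDyer.BirchSwinnertonDyer.Theorems.PrintCFramBottomClassIndexLawFiveLeCuspSeedAbelResidueMellin

set_option autoImplicit false

/-!
# Crux `PrintCFram.BottomClassIndexLawFiveLe` (stmt-BirchSwinnertonDyer-20372), line `eisenstein-resource-bdp-line` (registry v24):
# (E4) OF THE CUSP-CONJUNCT ASSEMBLY, PART 2 — «ABEL MEANS OF DIRICHLET COEFFICIENTS ⟹ RESIDUE OF THE `L`-SERIES»
# (cell `bsd-print-cfram`, width seat `bsd-line-cfram-p1-w5` g6; THEOREMS ONLY, `--supports` 20372; Mathlib currency;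
# BSD is not proved by any of this)

HONEST FRAMING. General analytic plumbing (no elliptic curve, no BSD), continuing
`…CuspSeedAbelResidueMellin.lean` (`CuspSeed.tendsto_sub_mul_mellin`: Abel limit at `0⁺` ⟹ residue of the Mellin transform).
Here the Mellin transform is specialised to the Abel generating function `t ↦ Σ_n a(n) e^{−2πnt}` of a Dirichlet series:

* `integrableOn_rpow_smul_tsum_mul_exp` — `t^w Σ_n a(n)e^{−2πnt}` is integrable on `(0,∞)` when `L(a, w+1)` converges absolutely
  (termwise Gamma integrals, summable `L¹` norms `‖a n‖Γ(w+1)(2πn)^{−(w+1)}`);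
* `mellin_tsum_mul_exp` — `𝓜(Σ_n a(n)e^{−2πnt})(s) = Γ(s)(2π)^{−s} L(a,s)` for real `s > 0` (Mathlib `hasSum_mellin`);
* **`tendsto_sub_mul_LSeries_of_tendsto_rpow_smul_tsum`** — if `L(a,s)` converges for every real `s > w > 0` and
  `t^w Σ_n a(n)e^{−2πnt} → ℓ` (`t → 0⁺`), then `(s − w) L(a,s) → (2π)^w/Γ(w) · ℓ` (`s → w⁺`).

Use in the line (crux notes `Lines/eisenstein-resource-bdp-line-w5g5-cusp-seed.md` §§2–5, §15 item (E)): with Lemma A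
(`CuspSeed.tendsto_zpow_mul_apply_ofComplex_I_mul`, p691154) the constant term at the cusp `0` of the integral-weight vehicle
`F_e · θ(Q²·)` is an Abel limit of the cut Cohen coefficients; this file converts it into the residue at `s = k + 1/2` of
`L(F_e, s) = Σ_{n'} H(k, m n') n'^{−s}`, which Lemmas B–D compute by Rankin-type unfolding. No Tauberian theorem is used.
[folklore]

References: [DiamondShurman2005] §5.9–5.10; Mathlib `Mathlib.NumberTheory.LSeries.MellinEqDirichlet`.
-/

-- summit-side namespace `Summit.BirchSwinnertonDyer.BirchSwinnertonDyer.…` (single-conjunct summit, D-0017 layout)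
set_option linter.dupNamespace false

namespace Summit.BirchSwinnertonDyer.BirchSwinnertonDyer.Theorems.PrintCFram.CuspSeed

open Filter Set MeasureTheory Real
open scoped Topology

/-! ## §4 From the Abel means of Dirichlet coefficients to the residue of the `L`-series -/

/-- For `c > 0` and real `s`, `e^{−c n} ≤ n^{−s}` for all large natural `n`. [folklore] -/
theorem eventually_exp_neg_mul_le_rpow_neg {c : ℝ} (hc : 0 < c) (s : ℝ) :
    ∀ᶠ n : ℕ in atTop, Real.exp (-(c * n)) ≤ (n : ℝ) ^ (-s) := by
  have h := (tendsto_rpow_mul_exp_neg_mul_atTop_nhds_zero s c hc).comp tendsto_natCast_atTop_atTop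
  have h1 : ∀ᶠ n : ℕ in atTop, (n : ℝ) ^ s * Real.exp (-c * n) < 1 := (tendsto_order.1 h).2 1 one_pos
  filter_upwards [h1, eventually_ge_atTop 1] with n hn hn1
  have hnpos : 0 < (n : ℝ) ^ s := Real.rpow_pos_of_pos (by exact_mod_cast hn1) s
  have hle : Real.exp (-(c * n)) * (n : ℝ) ^ s ≤ 1 := by
    rw [mul_comm, ← neg_mul]
    exact hn.le
  calc Real.exp (-(c * n)) = Real.exp (-(c * n)) * (n : ℝ) ^ s * ((n : ℝ) ^ s)⁻¹ := by
        rw [mul_assoc, mul_inv_cancel₀ hnpos.ne', mul_one]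
    _ ≤ 1 * ((n : ℝ) ^ s)⁻¹ := by gcongr
    _ = (n : ℝ) ^ (-s) := by rw [one_mul, Real.rpow_neg (Nat.cast_nonneg n)]

/-- For `t > 0`, `Σ ‖a n‖ e^{−2πnt}` converges as soon as the `L`-series of `a` converges (absolutely) at some real
point. [folklore] -/
theorem summable_norm_mul_exp_of_LSeriesSummable {a : ℕ → ℂ} {s : ℝ} (hs : LSeriesSummable a s) {t : ℝ}
    (ht : 0 < t) : Summable fun n : ℕ ↦ ‖a n‖ * Real.exp (-(2 * π * n * t)) := by
  have hnorm : Summable fun n : ℕ ↦ ‖LSeries.term a s n‖ := summable_norm_iff.mpr hs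
  refine hnorm.of_norm_bounded_eventually ?_
  rw [Nat.cofinite_eq_atTop]
  filter_upwards [eventually_exp_neg_mul_le_rpow_neg (c := 2 * π * t) (by positivity) s, eventually_ne_atTop 0]
    with n hn hn0
  rw [norm_mul, norm_norm, Real.norm_of_nonneg (Real.exp_pos _).le, LSeries.norm_term_eq, if_neg hn0,
    div_eq_mul_inv, ← Real.rpow_neg (Nat.cast_nonneg n)]
  refine mul_le_mul_of_nonneg_left ?_ (norm_nonneg _)
  rw [show 2 * π * (n : ℝ) * t = 2 * π * t * n by ring]
  exact hn

/-- For `t > 0`, the complex Abel series `Σ a(n) e^{−2πnt}` converges absolutely under the same hypothesis. [folklore] -/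
theorem summable_mul_exp_of_LSeriesSummable {a : ℕ → ℂ} {s : ℝ} (hs : LSeriesSummable a s) {t : ℝ}
    (ht : 0 < t) : Summable fun n : ℕ ↦ a n * (Real.exp (-(2 * π * n * t)) : ℂ) := by
  refine Summable.of_norm ?_
  refine (summable_norm_mul_exp_of_LSeriesSummable hs ht).of_nonneg_of_le (fun _ ↦ norm_nonneg _) fun n ↦ ?_
  rw [norm_mul, Complex.norm_real, Real.norm_of_nonneg (Real.exp_pos _).le]

/-- The `n`-th term `t ↦ t^w · a · e^{−2πnt}` (`n ≥ 1`, `w > -1`) is integrable on `(0,∞)` (a scaled Gamma integral).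
[folklore] -/
theorem integrableOn_rpow_smul_mul_exp {w : ℝ} (hw : -1 < w) (c : ℂ) {n : ℕ} (hn : n ≠ 0) :
    IntegrableOn (fun t : ℝ ↦ (t ^ w) • (c * (Real.exp (-(2 * π * n * t)) : ℂ))) (Ioi 0) := by
  have hr : 0 < 2 * π * (n : ℝ) := by positivity
  have h0 := Real.GammaIntegral_convergent (by linarith : 0 < w + 1)
  have h1 : IntegrableOn (fun t : ℝ ↦ Real.exp (-(2 * π * n * t)) * (2 * π * n * t) ^ (w + 1 - 1)) (Ioi 0) := by
    have := (integrableOn_Ioi_comp_mul_left_iff (fun x : ℝ ↦ Real.exp (-x) * x ^ (w + 1 - 1)) 0 hr).2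
      (by simpa only [mul_zero] using h0)
    simpa only using this
  have h2 : IntegrableOn (fun t : ℝ ↦ t ^ w * Real.exp (-(2 * π * n * t))) (Ioi 0) := by
    refine IntegrableOn.congr_fun (h1.const_mul ((2 * π * n) ^ w)⁻¹) (fun t (ht : 0 < t) ↦ ?_) measurableSet_Ioi
    show ((2 * π * ↑n) ^ w)⁻¹ * (Real.exp (-(2 * π * n * t)) * (2 * π * n * t) ^ (w + 1 - 1)) = _
    rw [add_sub_cancel_right, Real.mul_rpow hr.le ht.le]
    field_simp
  refine IntegrableOn.congr_fun ((h2.ofReal).const_mul c) (fun t _ ↦ ?_) measurableSet_Ioi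
  show c * ((t ^ w * Real.exp (-(2 * π * n * t)) : ℝ) : ℂ) = (t ^ w) • (c * (Real.exp (-(2 * π * n * t)) : ℂ))
  rw [Complex.real_smul]
  push_cast
  ring

/-- If `a 0 = 0` and the `L`-series of `a` converges at the real point `w + 1 > 0`, then
`t ↦ t^w · Σ_n a(n) e^{−2πnt}` is integrable on `(0, ∞)` (termwise Gamma integrals with summable `L¹` norms
`‖a n‖ Γ(w+1) (2πn)^{−(w+1)}`). [folklore] -/
theorem integrableOn_rpow_smul_tsum_mul_exp {a : ℕ → ℂ} (ha0 : a 0 = 0) {w : ℝ} (hw : -1 < w)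
    (hsum : LSeriesSummable a (w + 1 : ℝ)) :
    IntegrableOn (fun t : ℝ ↦ (t ^ w) • ∑' n : ℕ, a n * (Real.exp (-(2 * π * n * t)) : ℂ)) (Ioi 0) := by
  have heq : EqOn (fun t : ℝ ↦ ∑' n : ℕ, (t ^ w) • (a n * (Real.exp (-(2 * π * n * t)) : ℂ)))
      (fun t : ℝ ↦ (t ^ w) • ∑' n : ℕ, a n * (Real.exp (-(2 * π * n * t)) : ℂ)) (Ioi 0) := by
    intro t _
    simp only [Complex.real_smul]
    exact tsum_mul_left
  refine IntegrableOn.congr_fun ?_ heq measurableSet_Ioi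
  have hterm : ∀ n : ℕ, IntegrableOn (fun t : ℝ ↦ (t ^ w) • (a n * (Real.exp (-(2 * π * n * t)) : ℂ))) (Ioi 0) := by
    intro n
    rcases eq_or_ne n 0 with rfl | hn
    · simp only [ha0, zero_mul, smul_zero]
      exact integrableOn_zero
    · exact integrableOn_rpow_smul_mul_exp hw (a n) hn
  refine integrable_tsum_of_summable_integral_norm (μ := volume.restrict (Ioi (0 : ℝ)))
    (F := fun (n : ℕ) (t : ℝ) ↦ (t ^ w) • (a n * (Real.exp (-(2 * π * n * t)) : ℂ))) hterm ?_
  -- the `L¹` norms are summable: `‖a n‖ Γ(w+1) / (2πn)^{w+1}`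
  have hS : Summable fun n : ℕ ↦ Real.Gamma (w + 1) * (2 * π) ^ (-(w + 1)) * ‖LSeries.term a (w + 1 : ℝ) n‖ :=
    (summable_norm_iff.mpr hsum).mul_left _
  refine hS.of_nonneg_of_le (fun n ↦ integral_nonneg fun _ ↦ norm_nonneg _) fun n ↦ ?_
  rcases eq_or_ne n 0 with rfl | hn
  · simp [ha0]
  have hr : 0 < 2 * π * (n : ℝ) := by positivity
  have hcalc : ∫ t in Ioi (0 : ℝ), ‖(t ^ w) • (a n * (Real.exp (-(2 * π * n * t)) : ℂ))‖ =
      ‖a n‖ * ((1 / (2 * π * n)) ^ (w + 1) * Real.Gamma (w + 1)) := by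
    rw [← Real.integral_rpow_mul_exp_neg_mul_Ioi (by linarith) hr, ← integral_const_mul]
    refine setIntegral_congr_fun measurableSet_Ioi fun t (ht : 0 < t) ↦ ?_
    rw [norm_smul, norm_mul, Complex.norm_real, Real.norm_of_nonneg (Real.exp_pos _).le,
      Real.norm_of_nonneg (Real.rpow_nonneg ht.le _), add_sub_cancel_right]
    ring
  rw [hcalc, LSeries.norm_term_eq, if_neg hn, one_div, Real.inv_rpow hr.le,
    Real.mul_rpow (by positivity) (Nat.cast_nonneg n), Real.rpow_neg (by positivity : (0 : ℝ) ≤ 2 * π),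
    Complex.ofReal_re]
  apply le_of_eq
  field_simp

/-- **Mellin transform = Dirichlet series** for the Abel generating function: if `a 0 = 0` and the `L`-series of `a`
converges at the real point `s > 0`, then `𝓜(Σ_n a(n) e^{−2πnt})(s) = Γ(s) (2π)^{−s} · L(a, s)` (Mathlib `hasSum_mellin`).
[folklore] -/
theorem mellin_tsum_mul_exp {a : ℕ → ℂ} (ha0 : a 0 = 0) {s : ℝ} (hs : 0 < s) (hsum : LSeriesSummable a s) :
    mellin (fun t : ℝ ↦ ∑' n : ℕ, a n * (Real.exp (-(2 * π * n * t)) : ℂ)) s =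
      ((Real.Gamma s * (2 * π) ^ (-s) : ℝ) : ℂ) * LSeries a s := by
  have hs0 : 0 < (s : ℂ).re := by simp only [Complex.ofReal_re]; exact hs
  have hp : ∀ n : ℕ, a n = 0 ∨ 0 < 2 * π * (n : ℝ) := by
    intro n
    rcases Nat.eq_zero_or_pos n with rfl | hn
    · exact Or.inl ha0
    · exact Or.inr (by positivity)
  have hF : ∀ t ∈ Ioi (0 : ℝ), HasSum (fun n : ℕ ↦ a n * (Real.exp (-(2 * π * (n : ℝ)) * t) : ℂ))
      (∑' n : ℕ, a n * (Real.exp (-(2 * π * n * t)) : ℂ)) := by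
    intro t ht
    have h := (summable_mul_exp_of_LSeriesSummable hsum ht).hasSum
    convert h using 4
    ring
  have h_sum : Summable fun n : ℕ ↦ ‖a n‖ / (2 * π * (n : ℝ)) ^ (s : ℂ).re := by
    simp only [Complex.ofReal_re]
    have hn := (summable_norm_iff.mpr hsum).mul_left ((2 * π) ^ (-s))
    refine hn.of_nonneg_of_le (fun n ↦ by positivity) fun n ↦ ?_
    rcases eq_or_ne n 0 with rfl | hn0
    · simp [ha0]
    · rw [LSeries.norm_term_eq, if_neg hn0, Real.mul_rpow (by positivity) (Nat.cast_nonneg n),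
        Real.rpow_neg (by positivity : (0 : ℝ) ≤ 2 * π), Complex.ofReal_re]
      apply le_of_eq
      field_simp
  have hmain := hasSum_mellin hp hs0 hF h_sum
  have h2 : HasSum (fun n : ℕ ↦ ((Real.Gamma s * (2 * π) ^ (-s) : ℝ) : ℂ) * LSeries.term a s n)
      (((Real.Gamma s * (2 * π) ^ (-s) : ℝ) : ℂ) * LSeries a s) := hsum.hasSum.mul_left _
  refine hmain.unique ?_
  convert h2 using 2 with n
  rcases eq_or_ne n 0 with rfl | hn0
  · simp [ha0]
  · have hnpos : 0 < (n : ℝ) := by exact_mod_cast Nat.pos_of_ne_zero hn0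
    have h1 : (((n : ℝ) ^ s : ℝ) : ℂ) ≠ 0 := by exact_mod_cast (Real.rpow_pos_of_pos hnpos s).ne'
    have h2 : (((2 * π) ^ s : ℝ) : ℂ) ≠ 0 := by exact_mod_cast (Real.rpow_pos_of_pos Real.two_pi_pos s).ne'
    have hΓ : Complex.Gamma (s : ℂ) = (Real.Gamma s : ℂ) := Complex.Gamma_ofReal s
    rw [LSeries.term_of_ne_zero hn0, hΓ, ← Complex.ofReal_cpow (by positivity) s,
      Real.mul_rpow (by positivity) (Nat.cast_nonneg n), ← Complex.ofReal_natCast,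
      ← Complex.ofReal_cpow (Nat.cast_nonneg n) s, Real.rpow_neg Real.two_pi_pos.le]
    push_cast
    field_simp

/-- `s ↦ Γ(s) (2π)^{−s}` is continuous at `w > 0` (within `(w, ∞)`), with a non-zero value. [folklore] -/
theorem tendsto_Gamma_mul_two_pi_rpow_neg {w : ℝ} (hw : 0 < w) :
    Tendsto (fun s : ℝ ↦ Real.Gamma s * (2 * π) ^ (-s)) (𝓝[>] w) (𝓝 (Real.Gamma w * (2 * π) ^ (-w))) := by
  have h1 : ContinuousAt Real.Gamma w := by
    refine (Real.differentiableAt_Gamma fun m ↦ ?_).continuousAt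
    have : (0 : ℝ) ≤ m := Nat.cast_nonneg m
    intro h
    linarith
  have h2 : ContinuousAt (fun s : ℝ ↦ (2 * π) ^ (-s)) w :=
    (Real.continuousAt_const_rpow (b := -w) Real.two_pi_pos.ne').comp continuous_neg.continuousAt
  exact (h1.mul h2).tendsto.mono_left nhdsWithin_le_nhds

/-- **Abel means ⟹ residue of the `L`-series** (version with `a 0 = 0`). [folklore] -/
theorem tendsto_sub_mul_LSeries_of_tendsto_rpow_smul_tsum₀ {a : ℕ → ℂ} (ha0 : a 0 = 0) {w : ℝ} (hw : 0 < w)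
    {ℓ : ℂ} (hsum : ∀ s : ℝ, w < s → LSeriesSummable a s)
    (hlim : Tendsto (fun t : ℝ ↦ (t ^ w) • ∑' n : ℕ, a n * (Real.exp (-(2 * π * n * t)) : ℂ)) (𝓝[>] 0) (𝓝 ℓ)) :
    Tendsto (fun s : ℝ ↦ ((s - w : ℝ) : ℂ) * LSeries a s) (𝓝[>] w)
      (𝓝 ((((2 * π) ^ w / Real.Gamma w : ℝ) : ℂ) * ℓ)) := by
  set F : ℝ → ℂ := fun t ↦ ∑' n : ℕ, a n * (Real.exp (-(2 * π * n * t)) : ℂ) with hF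
  have hint : IntegrableOn (fun t : ℝ ↦ (t ^ w) • F t) (Ioi 0) :=
    integrableOn_rpow_smul_tsum_mul_exp ha0 (by linarith) (hsum _ (by linarith))
  have hM := tendsto_sub_mul_mellin hint hlim
  have hCne : Real.Gamma w * (2 * π) ^ (-w) ≠ 0 :=
    mul_ne_zero (Real.Gamma_pos_of_pos hw).ne' (Real.rpow_pos_of_pos Real.two_pi_pos _).ne'
  have hev : (fun s : ℝ ↦ ((s - w : ℝ) : ℂ) * LSeries a s) =ᶠ[𝓝[>] w] fun s ↦
      (((s - w : ℝ) : ℂ) * mellin F s) / ((Real.Gamma s * (2 * π) ^ (-s) : ℝ) : ℂ) := by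
    filter_upwards [self_mem_nhdsWithin] with s (hs : w < s)
    have hCs : ((Real.Gamma s * (2 * π) ^ (-s) : ℝ) : ℂ) ≠ 0 := by
      exact_mod_cast mul_ne_zero (Real.Gamma_pos_of_pos (hw.trans hs)).ne'
        (Real.rpow_pos_of_pos Real.two_pi_pos _).ne'
    rw [hF, mellin_tsum_mul_exp ha0 (hw.trans hs) (hsum s hs)]
    field_simp
  rw [tendsto_congr' hev]
  have hC' : Tendsto (fun s : ℝ ↦ ((Real.Gamma s * (2 * π) ^ (-s) : ℝ) : ℂ)) (𝓝[>] w)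
      (𝓝 ((Real.Gamma w * (2 * π) ^ (-w) : ℝ) : ℂ)) :=
    (Complex.continuous_ofReal.tendsto _).comp (tendsto_Gamma_mul_two_pi_rpow_neg hw)
  have h := hM.div hC' (by exact_mod_cast hCne)
  refine h.congr' (Eventually.of_forall fun _ ↦ rfl) |>.trans ?_  -- same function; adjust the limit value
  apply le_of_eq
  congr 1
  have hΓ : (Real.Gamma w : ℂ) ≠ 0 := by exact_mod_cast (Real.Gamma_pos_of_pos hw).ne'
  have hπ : (((2 * π) ^ w : ℝ) : ℂ) ≠ 0 := by exact_mod_cast (Real.rpow_pos_of_pos Real.two_pi_pos _).ne'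
  rw [Real.rpow_neg Real.two_pi_pos.le]
  push_cast
  field_simp

/-- **Abel means ⟹ residue of the `L`-series.** Let `a : ℕ → ℂ` have an `L`-series converging at every real `s > w`
(`w > 0`), and suppose the Abel means satisfy `t^w · Σ_n a(n) e^{−2πnt} → ℓ` as `t → 0⁺`. Then
`(s − w) · L(a, s) → (2π)^w / Γ(w) · ℓ` as `s → w⁺` (real `s`).
This is the bridge between the constant term of a modular form at the cusp `0` (an Abel limit of its Fourier coefficients
at `∞`: Lemma A `tendsto_zpow_mul_apply_ofComplex_I_mul` of this namespace) and the residue of its `L`-series at `s = w`,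
which is what the Rankin-type computation of the cusp constant of the `m`-cut Cohen–Eisenstein series evaluates (crux notes
`Lines/eisenstein-resource-bdp-line-w5g5-cusp-seed.md` §§2–5: `P = (2π)^{−w} Γ(w) · Res_{s=w} L(F_e, s)`). The coefficient
`a 0` is irrelevant (`t^w a(0) → 0`, and `L(a,s)` ignores it). Proof: Mellin transform (Mathlib `hasSum_mellin`) and
`tendsto_sub_mul_mellin`. [folklore] -/
theorem tendsto_sub_mul_LSeries_of_tendsto_rpow_smul_tsum {a : ℕ → ℂ} {w : ℝ} (hw : 0 < w) {ℓ : ℂ}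
    (hsum : ∀ s : ℝ, w < s → LSeriesSummable a s)
    (hlim : Tendsto (fun t : ℝ ↦ (t ^ w) • ∑' n : ℕ, a n * (Real.exp (-(2 * π * n * t)) : ℂ)) (𝓝[>] 0) (𝓝 ℓ)) :
    Tendsto (fun s : ℝ ↦ ((s - w : ℝ) : ℂ) * LSeries a s) (𝓝[>] w)
      (𝓝 ((((2 * π) ^ w / Real.Gamma w : ℝ) : ℂ) * ℓ)) := by
  -- drop the constant coefficient
  set a' : ℕ → ℂ := fun n ↦ if n = 0 then 0 else a n with ha'
  have ha'0 : a' 0 = 0 := by simp [ha']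
  have ha'n : ∀ {n : ℕ}, n ≠ 0 → a' n = a n := fun hn ↦ by simp [ha', hn]
  have hw1 : w < w + 1 := by linarith
  have hL : ∀ s : ℝ, LSeries a' s = LSeries a s := fun s ↦ LSeries_congr (fun hn ↦ ha'n hn) s
  have hsum' : ∀ s : ℝ, w < s → LSeriesSummable a' s :=
    fun s hs ↦ (LSeriesSummable_congr s fun hn ↦ ha'n hn).mpr (hsum s hs)
  -- the Abel series of `a'` is that of `a` minus `a 0`
  have hsA : ∀ {t : ℝ}, 0 < t → Summable fun n : ℕ ↦ a n * (Real.exp (-(2 * π * n * t)) : ℂ) :=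
    fun ht ↦ summable_mul_exp_of_LSeriesSummable (hsum _ hw1) ht
  have hsA' : ∀ {t : ℝ}, 0 < t → Summable fun n : ℕ ↦ a' n * (Real.exp (-(2 * π * n * t)) : ℂ) :=
    fun ht ↦ summable_mul_exp_of_LSeriesSummable (hsum' _ hw1) ht
  have hFA : ∀ {t : ℝ}, 0 < t → (∑' n : ℕ, a' n * (Real.exp (-(2 * π * n * t)) : ℂ)) =
      (∑' n : ℕ, a n * (Real.exp (-(2 * π * n * t)) : ℂ)) - a 0 := by
    intro t ht
    rw [(hsA ht).tsum_eq_zero_add, (hsA' ht).tsum_eq_zero_add]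
    simp [ha']
  have hlim' : Tendsto (fun t : ℝ ↦ (t ^ w) • ∑' n : ℕ, a' n * (Real.exp (-(2 * π * n * t)) : ℂ))
      (𝓝[>] 0) (𝓝 ℓ) := by
    have h0 : Tendsto (fun t : ℝ ↦ (t ^ w) • a 0) (𝓝[>] 0) (𝓝 0) := by
      have h := (((Real.continuousAt_rpow_const 0 w (Or.inr hw.le)).tendsto.mono_left
        (nhdsWithin_le_nhds (s := Ioi (0 : ℝ)))).smul_const (a 0))
      simpa [Real.zero_rpow hw.ne'] using h
    have h := hlim.sub h0
    rw [sub_zero] at h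
    refine h.congr' ?_
    filter_upwards [self_mem_nhdsWithin] with t (ht : 0 < t)
    rw [hFA ht, smul_sub]
  have h := tendsto_sub_mul_LSeries_of_tendsto_rpow_smul_tsum₀ ha'0 hw hsum' hlim'
  simpa only [hL] using h

end Summit.BirchSwinnertonDyer.BirchSwinnertonDyer.Theorems.PrintCFram.CuspSeed
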